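import Mathlib
import HarnessLib
import HarnessLib.Audit
import Summits.AtomisticToContinuum.Statement
import Literature.MathematicalPhysics.StatisticalMechanics.BarlowStacking
import Literature.MathematicalPhysics.StatisticalMechanics.LennardJonesClusters

/-!
Route: ExcessDecayRegularity

CLOSED (retired) 2026-08-15T13:42:13Z by operator:999:1257524 — reason: not-a-thesis: assembly does not conclude the sub-problem Statement — note: D-0027 §2.1 audit (human 2026-08-15: routes that do not decide the summit are removed): the assembly concludes `Literature.MathematicalPhysics.StatisticalMechanics.Crystallization`, not the sub-problem statement; a NEW conforming route may be opened from the same idea (generated `closes : … → _root_. The file is kept as the record of this route; refuted decls are indexed as negative knowledge (`ledger negatives`).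

It suffices to show X := FINE GRAINS (realising card excess-decay-epsilon-regularity, ideator-8;
refuter audits R4/R12 folded in): for every radius ρ and tolerance ε > 0, every sufficiently large
Lennard-Jones ground state in ℝ³ contains a ball of radius ρ on which the configuration is two-way
ε-matched with an affine image of the hcp TWO-lattice, {t_m + A z : m ∈ {0,1}, z ∈ Λ}, Λ = ℤu + ℤv +
ℤ·2√(2/3)e₃ the hexagonal period lattice of the unit hcp stacking (u = triangularVec₁ 1, v =
triangularVec₂ 1), the two sublattices translated independently (inner displacement free: hcp is not
a Bravais lattice) and A within 1/40 (operator norm) of 0.97·O(3) ("admissible cell": covers the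
relaxed LJ spacing a* = 0.9712, the relaxed c/a and O(1/R) residual strains).
X → IsCrystallizing lennardJones 3 is soft (support LimitGlue: compactness of admissible cells + the
proved criterion PeriodicConfiguration.tendsto_sum_of_eventually_near' +
LennardJonesMinimalDistance_holds; an affinely strained hcp is still periodic, so NO control of
residual strain is needed and the card's Laplace-pressure step is dropped); with the shared
energetic half (CrysPeriodicMinAttained = stmt-0627, CrysEnergyLimit = stmt-0626) it gives
Crystallization through crystallization_of_isLeast_tendsto_isCrystallizing (stmt-0622, proved).
The content is the decomposition of X by REGULARITY OF CRITICAL POINTS (two layers, cruxes first): X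
⇐ CoarseGrains (rank 2: grains at the single coarse tolerance 1/40, every radius — the only
LJ-energetic input) + HcpLiouville (rank 3: every infinite separated LJ EQUILIBRIUM that is globally
1/40-close to an admissible affine hcp two-lattice IS one — the blow-down form of Allard-type
ε-regularity, conditional on harmonic stability) + PhononStability (rank 4: certified acoustic +
optical stability of LJ over the admissible window), glued by compactness (support GrainsGlue: local
limits of ground states around coarse grains are infinite equilibria; Liouville makes them exact;
exactness comes back as fineness). Supports ExcessDecay (the rate form of (ER), engine of
Liouville's small-tolerance regime) and ForceBalance are filed as foreseen lemmas.
Lean: `let Λ : Set (EuclideanSpace ℝ (Fin 3)) := {z | ∃ i j k : ℤ, z = (i : ℝ) •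
Literature.MathematicalPhysics.StatisticalMechanics.triangularVec₁ 1 + (j : ℝ) •
Literature.MathematicalPhysics.StatisticalMechanics.triangularVec₂ 1 + (k : ℝ) •
Literature.MathematicalPhysics.StatisticalMechanics.layerNormal (2 * Real.sqrt (2 / 3))}; let Near :
Set (EuclideanSpace ℝ (Fin 3)) → EuclideanSpace ℝ (Fin 3) → ℝ → (Fin 2 → EuclideanSpace ℝ (Fin 3)) →
(EuclideanSpace ℝ (Fin 3) →L[ℝ] EuclideanSpace ℝ (Fin 3)) → ℝ → Prop := fun X c r t A ε => (∀ p ∈ X,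
dist p c ≤ r → ∃ m : Fin 2, ∃ z ∈ Λ, dist p (t m + A z) ≤ ε) ∧ (∀ m : Fin 2, ∀ z ∈ Λ, dist (t m + A
z) c ≤ r → ∃ p ∈ X, dist p (t m + A z) ≤ ε); let Adm : (EuclideanSpace ℝ (Fin 3) →L[ℝ]
EuclideanSpace ℝ (Fin 3)) → Prop := fun A => ∃ R : EuclideanSpace ℝ (Fin 3) ≃ₗᵢ[ℝ] EuclideanSpace ℝ
(Fin 3), ‖A - (97 / 100 : ℝ) • (R.toContinuousLinearEquiv : EuclideanSpace ℝ (Fin 3) →L[ℝ]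
EuclideanSpace ℝ (Fin 3))‖ ≤ 1 / 40; ∀ ρ ε : ℝ, 0 < ρ → 0 < ε → ∃ N₀ : ℕ, ∀ N : ℕ, N₀ ≤ N → ∀ x :
Fin N → EuclideanSpace ℝ (Fin 3), Literature.MathematicalPhysics.StatisticalMechanics.IsGroundState
Literature.MathematicalPhysics.StatisticalMechanics.lennardJones x → ∃ (c : EuclideanSpace ℝ (Fin
3)) (t : Fin 2 → EuclideanSpace ℝ (Fin 3)) (A : EuclideanSpace ℝ (Fin 3) →L[ℝ] EuclideanSpace ℝ (Fin
3)), Adm A ∧ Near (Set.range x) c ρ t A ε`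

Rationale: WHY THIS LINE. Regularity is a property of CRITICAL POINTS: every partial-regularity theorem of
geometric analysis (De Giorgi, Allard1972, Schoen–Uhlenbeck) upgrades "small excess on a ball" to
"regular on the half-ball" from the Euler–Lagrange equation and the stability of the tangent object
alone, and its blow-down form is a Liouville theorem. Transplant with an explicit dictionary:
stationary varifold ↦ δ-separated Lennard-Jones equilibrium (per-particle force balance,
infinite-range pair sums); tilt/height excess on B_r ↦ sup-distance on B_r to an affine hcp
two-lattice (two sublattice translations + one admissible linear cell); tangent plane ↦ linear
elasticity plus optical modes of hcp (PhononStability); Allard's regularity theorem ↦ ExcessDecay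
(rate form) and its Liouville corollary ↦ HcpLiouville. Imported area and sources: elliptic
regularity for lattice systems — linearise-and-bootstrap with lattice Green's functions
(EhrlacherOrtnerShapeev2016 Thm 2: |Dū(ℓ)| ≲ |ℓ|^{-d} for energy-space critical points near a
Bravais lattice; OlsonOrtner2017 for multilattices), atomistic stability theory (HudsonOrtner2011,
EMing2006 incl. inner shifts of complex lattices, OrtnerTheil2012, SchmidtSteinbach2022), uniqueness
of near-affine equilibria (ContiEtAl2006), certified Hessians of LJ blocks (AyalaChoksiWirth2025);
the problem and its status from BlancLewin2015 §2.1–2.3. What this line does that the eight existing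
Crystallization routes do not: CrystalKissingRigidity, CrystalLocalRigidity, CrystalThreeCone,
HullPeriodicPoint, PoissonBesselStacking, MieLadderVdwKissing and BenjaminiSchrammGroundStates all
extract positional order from MINIMALITY (local energy inequalities, contact graphs, defect
densities at every tolerance, stationarity of limit laws); here the equilibrium EQUATIONS do the
fine work, so Lennard-Jones energetics are consumed at ONE tolerance on ONE ball per ground state
(CoarseGrains), and Blanc–Lewin (ii) needs no zero-strain lemma because an affinely strained hcp is
periodic. The negatives index is empty at filing; no refuted statement is approached.

RANKED CRUXES. #0 FineGrains (target) — FINE GRAINS (X; card excess-decay-epsilon-regularity, output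
of (CG)+(ER)): for all ρ, ε > 0 there is N₀ such that every Lennard-Jones ground state in ℝ³ with N
≥ N₀ particles contains a ball B_ρ(c) on which it is two-way ε-matched (every particle in the ball
within ε of a site, every site in the ball within ε of a particle) with an affine image of the hcp
TWO-lattice: sites t_m + A z, m ∈ {0,1}, z ∈ Λ = {i·u + j·v + k·2√(2/3)·e₃} (u = triangularVec₁ 1, v
= triangularVec₂ 1; the hexagonal period lattice of the unit hcp stacking), with independent
sublattice translations t : Fin 2 → ℝ³ (inner displacement free) and an admissible cell A, ‖A −
0.97·R‖ ≤ 1/40 in operator norm for some linear isometry R (0.97 ≈ relaxed LJ spacing a* =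
(A₁₂/A₆)^{1/6} = 0.9712; the window absorbs relaxation of a and c/a and O(1/R) residual strain).
Same strength as 'some local limit of translated ground states is an affinely strained hcp crystal';
X → IsCrystallizing is the support LimitGlue. [difficulty: open-problem] (why it might fail: False
iff LJ ground states contain no asymptotically perfect (affinely strained) hcp-type grains at all
scales: fcc/polytype or amorphous bulk, or persistent strain gradients in every window.)
[BlancLewin2015, Stillinger2001]
#2 CoarseGrains (crux) — COARSE GRAINS AT ONE TOLERANCE (card (CG)/C4; the LJ physics of the line):
for every R > 0 there is N₀ such that every Lennard-Jones ground state with N ≥ N₀ particles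
contains a ball B_R(c) two-way (1/40)-matched with an admissible affine hcp two-lattice t_m + A(Λ)
(‖A − 0.97R‖ ≤ 1/40) whose inner displacement is hcp-like (‖t₁ − t₀ − A(w + √(2/3)e₃)‖ ≤ 1/40, w =
barlowOffset 1). ONE window shape, ONE tolerance, no rate, no 'for every ε' — logically the weakest
positional input proposed on this summit (compare BulkDefectVanish stmt-0751: all but o(N)
particles, every R AND every ε; PeriodicWindows stmt-3240: every ε). Tolerance 1/40 is coarse enough
for contact-graph rigidity (bond lengths within a few % force it) yet below every known competing LJ
equilibrium (bcc ≈ 0.13 via the Burgers shuffle, stacking variants ≥ 0.28). Expected inputs when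
split later: cohesion at scale R (cf. NoFoam stmt-2912), local hcp-likeness of low-energy
neighbourhoods at tolerance 1/40, O(N^{2/3}) defect counting, stacking selection by the r⁻⁶ tail
(Hägg domination items 0716/0737). [difficulty: open-problem] (why it might fail:
Crystallization-strength LJ input: fails if large ground states are fcc/polytype-grained (hcp beats
fcc by only 7e-5/particle: hcp need not dominate before N~1e12, yet must eventually),
polytetrahedral/amorphous (IcosahedralClusters, TetrahedralFrustration), foamy, or strained beyond
the window.) [BlancLewin2015, Stillinger2001, KiharaKoba1952, PartayOrtnerCsanyi2017,
Literature.Barriers.AtomisticToContinuum.IcosahedralClusters,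
Literature.Barriers.AtomisticToContinuum.TetrahedralFrustration, stmt-AtomisticToContinuum-0751,
stmt-AtomisticToContinuum-2912]
#3 HcpLiouville (crux) — COARSE LIOUVILLE THEOREM FOR NEAR-HCP LJ EQUILIBRIA (the card's
ε-regularity (ER) in blow-down form; stated CONDITIONALLY on the harmonic-stability inequality of
PhononStability, which appears inline as the first hypothesis): for every δ > 0, every δ-separated
set X ⊂ ℝ³ in Lennard-Jones force balance (for each p ∈ X the force Σ_{q ∈ X, q ≠ p}
V′(|p−q|)(p−q)/|p−q| has sum 0, HasSum form; absolutely convergent by the r⁻⁷ decay) that is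
GLOBALLY (every centre, every radius) two-way (1/40)-matched with an admissible affine hcp
two-lattice datum (t, A) with hcp-like inner displacement, IS exactly an admissible affine hcp
two-lattice: X = {t′_m + A′z : m ∈ {0,1}, z ∈ Λ} with ‖A′ − 0.97R′‖ ≤ 1/40. (Uniformly strained
two-lattices with relaxed inner shift are equilibria and are allowed as conclusions; vacancies,
interstitials, faults, dislocations, half-crystals violate the two-way matching.) Regularity is a
property of CRITICAL POINTS: no minimality is assumed. Proof plan (layer 2): linear Liouville
(bounded solutions of the hcp force-constant system are translations — Fourier/Bloch +
PhononStability incl. optical branches), small-tolerance Liouville by iterating the excess-decay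
estimate (support ExcessDecay; lattice Green's function technology of
EhrlacherOrtnerShapeev2016/OlsonOrtner2017), and the COARSE BASIN 1/40 → ε₀ (no competing
equilibrium phase within sup-distance 1/40; CDKM-type uniqueness or certified numerics). [deps:
PhononStability] [difficulty: XL] (why it might fail: A competing LJ equilibrium within sup-distance
1/40 of affine hcp (modulated or inner-shifted two-lattice, static breather) refutes it;
anharmonicity |V‴/V″|≈20 at the bond length puts the perturbative (IFT) radius near 1/400, so the
coarse basin 1/40→ε₀ is the real bet; optical stability needed.) [EhrlacherOrtnerShapeev2016,
OlsonOrtner2017, EMing2006, ContiEtAl2006, Allard1972, HudsonOrtner2011, OrtnerTheil2012,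
BurrowsCooperSchwerdtfeger2021, Literature.Barriers.AtomisticToContinuum.HcpNotBravais]
#4 PhononStability (crux) — HARMONIC (ACOUSTIC + OPTICAL / INNER-DISPLACEMENT) STABILITY OF
LENNARD-JONES NEAR HCP, UNIFORM OVER THE ADMISSIBLE CELL WINDOW (card C1; a finite certified
computation): there is κ > 0 such that for every admissible cell A (‖A − 0.97R‖ ≤ 1/40), all
sublattice translations t with hcp-like inner displacement (within 1/40), and every finitely
supported displacement u of the site set S = {t_m + Az}, the second variation of the LJ energy, ½
Σ_{p≠q ∈ S} (u_p−u_q)ᵀ K(p−q) (u_p−u_q) with K(z) = V″(|z|) ẑ⊗ẑ + (V′(|z|)/|z|)(1 − ẑ⊗ẑ), V =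
r⁻¹²/12 − r⁻⁶/6, is ≥ κ · Σ_{p,q ∈ S, |p−q| ≤ 11/10} |u_p − u_q|² (nearest-neighbour strain norm;
inter-sublattice bonds included, so optical modes are controlled). Bloch reduction: a 6×6 Hermitian
family over (Brillouin zone) × (compact cell/shift window); interval arithmetic + explicit r⁻⁶/r⁻⁸
tail bounds + acoustic asymptotics D(q) ≥ c|q|² near q = 0 (Hudson–Ortner / Schmidt–Steinbach
stability constants); AyalaChoksiWirth2025 Thm 4.1/4.4 already certify the Γ-sector for an 864-atom
LJ fcc block. Also serves card energy-derivative-positional-order (H4). [difficulty: L] (why it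
might fail: The window is a guess: the inequality must survive 2.6% triaxial strain and 1/40 inner
shifts off equilibrium, where geometric-stress terms ΣV′/r of compressed bonds fight the moduli; LJ
lattices can be harmonically unstable (bcc: BurrowsCooperSchwerdtfeger2021); repair = shrink
window.) [HudsonOrtner2011, SchmidtSteinbach2022, AyalaChoksiWirth2025, EMing2006,
BurrowsCooperSchwerdtfeger2021, book:dove1993-introduction-lattice-dynamics]
#9 ExcessDecay (support) — EXCESS DECAY = ALLARD-TYPE ε-REGULARITY WITH RATE (card (ER) in the
absorbed form asked for by refuter R4; foreseen layer-2 child of HcpLiouville in the small-tolerance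
regime; conditional on the PhononStability inequality, inline): for every δ > 0 there are ε₀ > 0, θ
∈ (0,1), r₀ and C such that for every FINITE δ-separated LJ equilibrium X (force balance at every
particle), every ball B_r(c) with r ≥ r₀, every admissible datum (t, A) with hcp-like inner
displacement and every ε ≤ ε₀: if X is two-way ε-matched with the datum on B_r(c) then on B_{θr}(c)
it is (ε/2 + C/r²)-matched with a corrected datum (t′, A′), ‖A′ − A‖ ≤ Cε/r. Mechanism: harmonic
approximation against the force-constant system of the nearest relaxed two-lattice, interior
(Campanato) estimates via the lattice Green's function, nonlinear remainder O(ε²) absorbed for ε ≤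
ε₀, exterior matter acting only through a force O(s⁻⁴) at depth s (r⁻⁶ tail + δ-separation) whence
the C/r² floor; iterate ~log(1/η) times to reach tolerance η. Sources: EhrlacherOrtnerShapeev2016
Thm 2 (decay at infinity for energy-space critical points), OlsonOrtner2017, EMing2006, Allard1972
(the template). [difficulty: L] [EhrlacherOrtnerShapeev2016, OlsonOrtner2017, EMing2006, Allard1972]
#9 ForceBalance (support) — GROUND STATES ARE FORCE-BALANCED POINT SETS: for every Lennard-Jones
ground state x (any N) and every particle p ∈ range x, Σ_{q ∈ range x, q ≠ p} V′(|p−q|)·(p−q)/|p−q|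
= 0 (HasSum over the finite subtype). Fermat at a minimum over the OPEN set of injective
configurations; V_LJ = r⁻¹²/12 − r⁻⁶/6 is smooth on (0, ∞), dist is smooth off the diagonal. Needed
by GrainsGlue. Provable now (Mathlib calculus: IsLocalMin.hasFDerivAt_eq_zero / HasDerivAt of r ↦
V(‖p + r e − q‖)). [difficulty: provable-now] [BlancLewin2015]
#9 GrainsGlue (support) — LAYER GLUE (foreseen split of the target): PhononStability → HcpLiouville
→ CoarseGrains → FineGrains. Proof by compactness and contradiction: if fine grains fail for some
(ρ, ε) along N_k → ∞, centre the coarse R_k-grains (R_k → ∞, CoarseGrains) of those ground states at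
0 (translates of ground states are ground states, CrystallizationSymmetries), normalise the data
(t_k modulo A_kΛ; A_k in the compact admissible set), extract a locally convergent subsequence of
the 1/3-separated translated configurations (LennardJonesMinimalDistance_holds; at most C n³ points
in B_n by card_le_of_separated_of_dist_le); the limit X_∞ is 1/3-separated, in force balance
(ForceBalance passes to the limit: near field by local convergence, far field Σ_{|q−p| ≥ L} |V′| ≤ C
L⁻⁴ uniformly by separation) and globally two-way 1/40-matched with the limit datum (closed
conditions; Λ discrete); HcpLiouville (its stability hypothesis discharged by PhononStability) makes
X_∞ an exact admissible two-lattice; local convergence then gives two-way ε-matching of X_k with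
that two-lattice on B_ρ(0) for large k — contradiction. [deps: PhononStability, HcpLiouville,
CoarseGrains, FineGrains, ForceBalance] [difficulty: L] [BlancLewin2015]
#9 LimitGlue (support) — FineGrains → IsCrystallizing lennardJones 3 (Blanc–Lewin (ii)): given
ground states (x N)_N take ρ_k = k, ε_k = 1/k and φ(k) ≥ N₀(k, 1/k) strictly increasing, with data
(c_k, t_k, A_k) from FineGrains; normalise t_k − c_k modulo A_kΛ (bounded), extract A_k → A, t_k → t
(admissible cells: a compact set of invertible maps, ‖A − 0.97R‖ ≤ 1/40 < 0.97); P := the periodic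
configuration with lattice A(Λ) = Submodule.span ℤ {A u, A v, 2√(2/3)·A e₃} (IsZLattice/discrete
since A is invertible) and motif {t₀, t₁} reduced modulo A(Λ) (a singleton if t₁ − t₀ ∈ A(Λ));
translations τ_j := −c_{φ j}; on a fixed ball B_R the matching error is ≤ 1/k + |t_k − t| + ‖A_k −
A‖·O(R) → 0, so PeriodicConfiguration.tendsto_sum_of_eventually_near'
(CrystallizationLocalLimit.lean) with δ = 1/3 from LennardJonesMinimalDistance_holds yields local
convergence with m ≡ 1 (an affinely strained hcp is still a PeriodicConfiguration, so no
zero-strain/Laplace lemma is needed). [deps: FineGrains] [difficulty: M] [BlancLewin2015]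
#9 CrysPeriodicMinAttained (support) — (shared item stmt-0627, conjunct (i) half, not this route's
thesis) the infimum over periodic configurations of ℝ³ of the Lennard-Jones energy per particle is
attained. [difficulty: open-problem] [BlancLewin2015]
#9 CrysEnergyLimit (support) — (shared item stmt-0626, conjunct (i) half) E(N)/N converges to the
infimum over periodic configurations of the LJ energy per particle in d = 3 (bookkeeping given 0627:
periodisation 0715 + trial blocks 0629 + stability 0713). [difficulty: M] [BlancLewin2015]

KILL CRITERIA. HcpLiouville REFUTED by a genuinely different near-hcp LJ equilibrium phase (an
infinite separated force-balanced X, globally 1/40-matched to an admissible datum, not a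
two-lattice): if the witness sits at sup-distance ≥ some explicit η from every two-lattice, ONE
repair (restate with tolerance η/2 in CoarseGrains/HcpLiouville) is allowed; a family of witnesses
at every tolerance closes the route (mechanism dead: hcp would not be an isolated equilibrium
phase). PhononStability REFUTED at a corner of the window → shrink the window once (restate);
refuted at the relaxed hcp cell itself → close (no linear stability, no regularity). CoarseGrains
REFUTED because LJ ground states are fcc-grained → sibling statements with the fcc Bravais reference
(one repair, same mechanism); refuted by amorphous/polytetrahedral bulk → close --reason
refuted:CoarseGrains (and every hcp/fcc route dies with it). Refutation of 0627 kills conjunct (i)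
for everyone (route RefuteCrystalPeriodicMin). Proof of BulkDefectVanish 0751 or PeriodicWindows
3240 elsewhere moots CoarseGrains (they imply it up to the affine window) but not HcpLiouville.

NOT DECOMPOSED YET. Deliberately not decomposed at open: (1) the three children of HcpLiouville
(linear Liouville / small Liouville via ExcessDecay / coarse basin) — they need an EXPLICIT ε₀
computed from the stability constant κ and derivative bounds of V over the window, which is
PhononStability's output; (2) the children of CoarseGrains (cohesion, local hcp-likeness at 1/40,
propagation) — wait for refuters to price the tolerance; (3) the explicit N₀(R), θ, C, r₀; (4) the
fcc sibling (reference fccStacking) — filed only if energetics force it; (5) the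
zero-mean-strain/Laplace-pressure lemma of the card — dropped, not postponed (not needed for (ii));
(6) conjunct (i): shared items 0627/0626 only; (7) definition requests (a named `TwoLatticeNear`
predicate and `ljForceConstantForm` would shorten the signatures; not needed for elaboration, so not
filed now).

CHEAPEST FALSIFIER. (a) kit, minutes: minimal eigenvalue of the 6×6 LJ-hcp Bloch force-constant
matrix D_A(q) over a q-grid of the Brillouin zone at the corners of the admissible window (A =
0.97(1 ± 1/40)·I, a 1/40 simple shear, a 1/40 inner shift; lattice sums to radius 12 + tail bound) —
one negative eigenvalue refutes PhononStability AS TYPED (repair: shrink window); a negative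
eigenvalue at the relaxed cell kills the line. (b) numerics, an hour: relax random
1/40-perturbations of hcp supercells (N ~ 10³, periodic) under LJ by force minimisation (not
energy): convergence to anything but a strained two-lattice exhibits a competing equilibrium and
refutes HcpLiouville at 1/40. (c) lookup, done: bcc (an LJ equilibrium, harmonically unstable per
BurrowsCooperSchwerdtfeger2021) is ≈0.13-close to affine hcp via the Burgers correspondence (shuffle
a√2/6 ≈ 0.27 d_NN split over two sublattices), stacking variants are ≥ a/(2√3) ≈ 0.28 away, the
Burgers-path saddle ≈ 0.08: all outside tolerance 1/40, so no KNOWN equilibrium refutes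
HcpLiouville.

TWO-LAYER PLAN. Foreseen glued splits (nothing filed now; D-0019, k ≤ 3, one layer):
HcpLiouville ⇐ LinearLiouville (bounded solutions of the hcp force-constant system are translations;
from PhononStability by Bloch/Fourier) → SmallLiouville (∃ ε₀: globally ε₀-matched separated
equilibria are exact two-lattices; from ExcessDecay iterated over all scales) → CoarseBasin
(globally 1/40-matched ⇒ globally ε₀-matched, with ε₀ made EXPLICIT from κ and bounds on V″, V‴ over
the window — the shared-threshold constraint forces an explicit ε₀ before this split) →
HcpLiouville.
CoarseGrains ⇐ Cohesion at scale R (no internal voids; cf. NoFoam stmt-2912) → LocalHcpLikeness (all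
but O(N^{2/3}) particles have a 1/40-hcp-matched neighbourhood of fixed radius, by local energy
accounting + contact-graph rigidity at coarse tolerance) → Propagation (adjacent coarse-matched
neighbourhoods share one affine datum up to 1/40 over radius R, pigeonhole on O(N^{2/3}) defects) →
CoarseGrains.
FineGrains ⇐ GrainsGlue (already filed as support: PhononStability → HcpLiouville → CoarseGrains →
FineGrains).

NUMBERS. V = r⁻¹²/12 − r⁻⁶/6 (BlancLewin2015 (3), r₀ = 1): V′ = −r⁻¹³ + r⁻⁷, V″ = 13r⁻¹⁴ − 7r⁻⁸,
V″(1) = 6, V‴(1) = −126 (|V‴/V″| = 21: force constants change by 100% under 5% bond strain — why the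
perturbative radius is ~1/400 and 1/40 is a bet); V″ = 0 at r = (13/7)^{1/6} = 1.1087. Lattice sums
(KiharaKoba1952/Stillinger2001): fcc A₆ = 14.45392, A₁₂ = 12.13188; hcp A₆ = 14.45489, A₁₂ =
12.13229; relaxed spacing a* = (A₁₂/A₆)^{1/6} = 0.9712 (both); e = −A₆²/(24A₁₂): e_hcp = −0.71759 <
e_fcc = −0.71752, gap 7e-5 per particle (so surface terms O(N^{2/3}) can mask hcp for N ≲ 1e12).
Admissible window: ‖A − 0.97R‖ ≤ 1/40 ⇒ bond lengths in [0.92, 1.02] incl. inner shift, V″ ∈ [3.9,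
28] > 0 there. Matching tolerance 1/40 = 0.025 vs: bcc–hcp Burgers shuffle ≈ 0.13 per atom, stacking
shift a/√3 = 0.56 (nearest wrong site 0.28), minimal distance of LJ ground states δ = 1/3
(LennardJonesMinimalDistance_holds) > 2·(1/40).

SOURCES. BlancLewin2015 (arXiv:1504.01153) §2.1 (15)–(17), §2.2, §2.3; Allard1972;
EhrlacherOrtnerShapeev2016 (arXiv:1306.5334) Thm 2, Lemma 5; OlsonOrtner2017 (arXiv:1608.08930);
EMing2006; HudsonOrtner2011; OrtnerTheil2012; ContiEtAl2006; FrieseckeTheil2002;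
SchmidtSteinbach2022 (arXiv:2205.04849) Thm 3.22/3.23; AyalaChoksiWirth2025 (arXiv:2506.22614) Thm
4.1/4.4; Stillinger2001; KiharaKoba1952; PartayOrtnerCsanyi2017; BurrowsCooperSchwerdtfeger2021;
book:dove1993-introduction-lattice-dynamics (Born stability); tree:
LennardJonesMinimalDistance_holds, PeriodicConfiguration.tendsto_sum_of_eventually_near',
crystallization_of_isLeast_tendsto_isCrystallizing, hcpPeriodicConfiguration_points.

DEFINITION REQUESTS. None filed: every statement elaborates over existing declarations
(BarlowStacking vectors triangularVec₁/triangularVec₂/barlowOffset/layerNormal, lennardJones,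
IsGroundState, Mathlib operator norms). Optional later (would shorten signatures, not change them):
Literature definition `TwoLatticeNear` (two-way matching with an affine two-lattice) and
`ljForceConstantForm` (the quadratic form K).

Novelty: Searches (2026-08-15; OpenAlex/S2/arXiv APIs answered HTTP 429 all session, so zbMATH, Crossref, the
local index and the galaxy corpora were used): lit search --source zbmath "Cauchy-Born" (25 hits;
relevant: EMing2006 doi:10.1007/s00205-006-0031-7, HudsonOrtner2011 doi:10.1051/m2an/2011014,
OrtnerTheil2012 doi:10.1007/s00205-012-0592-6, ContiEtAl2006 doi:10.4171/jems/65, FrieseckeTheil2002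
doi:10.1007/s00332-002-0495-z, Braides–Causin–Solci arXiv:2210.06147); zbmath "crystalline defects
atomistic equilibrium decay" (4: EhrlacherOrtnerShapeev2016 arXiv:1306.5334, Chen–Nazar–Ortner
arXiv:1709.02770, Braun–Hudson–Ortner arXiv:2108.04765, Buze–Hudson–Ortner arXiv:1810.05501); zbmath
"multilattices point defects regularity locality" (OlsonOrtner2017 arXiv:1608.08930); zbmath
"objective structures stability" (SchmidtSteinbach2022 arXiv:2205.04849, arXiv:2205.04840); zbmath
"crystallization conjecture" ≥ 2010 (23; none on regularity of equilibria); zbmath "Liouville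
discrete harmonic lattice elliptic system" (nil relevant); crossref "Cauchy-Born atomistic
uniqueness equilibrium stability" (12; Makridakis–Süli 2012 numerics only); lit galaxy search --star
all "Cauchy-Born rule and the stability of crystalline solids" (11 rows: Steinbach thesis "On the
Stability of Objective Structures", Braun thesis, a/c-coupling numerics); lit frontier / lit bridges
AtomisticToContinuum (no equilibrium-regularity entries); local hybrid index (held: Dove 1993
lattice dynamics, Knops–Payne 1971 uniqu  [refs: 10.1007/s00205-006-0031-7, 10.1051/m2an/2011014, 10.1007/s00205-012-0592-6, 10.4171/jems/65, 10.1007/s00332-002-0495-z, 2210.06147, 1306.5334, 1709.02770, 2108.04765, 1810.05501, 1608.08930, 2205.04849, 2205.04840, doi:10.1007/s00205-006-0031-7, doi:10.1051/m2an/2011014, doi:10.1007/s00205-012-0592-6, doi:10.4171/jems/65, doi:10.1007/s00332-002-0495-z, EMing2006, HudsonOrtner2011, OrtnerTheil2012,]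

Barriers (technique_class: elliptic-regularity, excess-decay, phonon-stability): - technique_class: elliptic-regularity, excess-decay, phonon-stability
- Literature.Barriers.AtomisticToContinuum.FlexibleKissingArrangements: evaded — no single-shell or
kissing rigidity is used anywhere; rigidity comes from the force-balance EQUATIONS plus bulk
harmonic stability (PhononStability), and matching is imposed on whole balls / globally
(HcpLiouville), where the flexible icosahedral shell (1/40-far from fcc/hcp patterns,
flexibleKissingArrangements_holds) cannot even occur inside a 1/40-matched region.
- Literature.Barriers.AtomisticToContinuum.KissingTwelveDegeneracy: evaded by not inferring stacking
from contacts: CoarseGrains ASSERTS an hcp-stacked grain (decided upstream by LJ energetics incl.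
the r⁻⁶ tail), and fcc / other Barlow stackings are ≥ 0.28 away from any affine hcp two-lattice,
outside tolerance 1/40, so HcpLiouville's hypothesis already fixes the stacking.
- Literature.Barriers.AtomisticToContinuum.ShortRangeStackingBlindness: same — stacking selection
lives inside CoarseGrains (rank 2) together with Hägg domination (items 0716/0737); HcpLiouville and
PhononStability use the full infinite-range potential, never a truncation.
- Literature.Barriers.AtomisticToContinuum.IcosahedralClusters: it does not evade it; the bet is
confined to CoarseGrains — icosahedral/polytetrahedral order must lose in LARGE ground states on at
least ONE ball per radius at ONE tolerance, the weakest form in which any route needs it.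
- Literature.Barriers.AtomisticToContinuu

Novelty grade: new-combination — route-review grade (refuter b16f6152; lit searchd unavailable this session, graded on the route's documented searches + own reading): nearest prior art = energy-space decay/regularity of atomistic CRITICAL points near Bravais/multi-lattices (EOS2016, OlsonOrtner2017) and local uniqueness near Cauchy (refuter refuter-rreview-route-AtomisticToContinu-b16f6152-0, 2026-08-15T13:51:36Z; prior: arXiv:1306.5334 (EhrlacherOrtnerShapeev2016 Thm 2), arXiv:1608.08930 (OlsonOrtner2017), doi:10.1007/s00205-006-0031-7 (EMing2006), Allard1972, arXiv:1504.01153 (BlancLewin2015 §2.1-2.3))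

History (route lifecycle, newest last):
- 2026-08-15T13:42:13Z · CLOSED retired — not-a-thesis: assembly does not conclude the sub-problem Statement (operator:999:1257524)

sub-problem: Crystallization · status: closed(retired) · opened planner-plancard-AtomisticToContinuum-Crystal-d9cbb74d-0 2026-08-15T11:29:08Z · rev 0 · ledger route-AtomisticToContinuum-ExcessDecayRegularity
GENERATED by the gate from the ledger (D-0016/17). Provers cite these decls: `theorem foo : Summit.AtomisticToContinuum.Crystallization.Theses.ExcessDecayRegularity.<Decl> := …` in Summits/AtomisticToContinuum/Crystallization/Theorems/<Name>.lean.
-/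

namespace Summit.AtomisticToContinuum.Crystallization.Theses.ExcessDecayRegularity

open scoped BigOperators Topology Manifold Classical MeasureTheory ProbabilityTheory Matrix InnerProductSpace ComplexConjugate ContinuousMap
open Filter Set Function TopologicalSpace MeasureTheory

attribute [summit_statement] _root_.Crystallization

/-- item stmt-AtomisticToContinuum-4175 · target · rank 0 · closed · moot by None · by planner
why it might fail: False iff LJ ground states contain no asymptotically perfect (affinely strained) hcp-type grains at all scales: fcc/polytype or amorphous bulk, or persistent strain gradients in every window.
sources: BlancLewin2015, Stillinger2001
[target] FINE GRAINS (X; card excess-decay-epsilon-regularity, output of (CG)+(ER)): for all ρ, ε >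
0 there is N₀ such that every Lennard-Jones ground state in ℝ³ with N ≥ N₀ particles contains a ball
B_ρ(c) on which it is two-way ε-matched (every particle in the ball within ε of a site, every site
in the ball within ε of a particle) with an affine image of the hcp TWO-lattice: sites t_m + A z, m
∈ {0,1}, z ∈ Λ = {i·u + j·v + k·2√(2/3)·e₃} (u = triangularVec₁ 1, v = triangularVec₂ 1; the
hexagonal period lattice of the unit hcp stacking), with independent sublattice translations t : Fin
2 → ℝ³ (inner displacement free) and an admissible cell A, ‖A − 0.97·R‖ ≤ 1/40 in operator norm for
some linear isometry R (0.97 ≈ relaxed LJ spacing a* = (A₁₂/A₆)^{1/6} = 0.9712; the window absorbs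
relaxation of a and c/a and O(1/R) residual strain). Same strength as 'some local limit of
translated ground states is an affinely strained hcp crystal'; X → IsCrystallizing is the support
LimitGlue. [difficulty: open-problem] -/
@[route_item "route-AtomisticToContinuum-ExcessDecayRegularity"]
def FineGrains : Prop :=
  let Λ : Set (EuclideanSpace ℝ (Fin 3)) := {z | ∃ i j k : ℤ, z = (i : ℝ) • Literature.MathematicalPhysics.StatisticalMechanics.triangularVec₁ 1 + (j : ℝ) • Literature.MathematicalPhysics.StatisticalMechanics.triangularVec₂ 1 + (k : ℝ) • Literature.MathematicalPhysics.StatisticalMechanics.layerNormal (2 * Real.sqrt (2 / 3))}; let Near : Set (EuclideanSpace ℝ (Fin 3)) → EuclideanSpace ℝ (Fin 3) → ℝ → (Fin 2 → EuclideanSpace ℝ (Fin 3)) → (EuclideanSpace ℝ (Fin 3) →L[ℝ] EuclideanSpace ℝ (Fin 3)) → ℝ → Prop := fun X c r t A ε => (∀ p ∈ X, dist p c ≤ r → ∃ m : Fin 2, ∃ z ∈ Λ, dist p (t m + A z) ≤ ε) ∧ (∀ m : Fin 2, ∀ z ∈ Λ, dist (t m + A z) c ≤ r → ∃ p ∈ X,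 dist p (t m + A z) ≤ ε); let Adm : (EuclideanSpace ℝ (Fin 3) →L[ℝ] EuclideanSpace ℝ (Fin 3)) → Prop := fun A => ∃ R : EuclideanSpace ℝ (Fin 3) ≃ₗᵢ[ℝ] EuclideanSpace ℝ (Fin 3), ‖A - (97 / 100 : ℝ) • (R.toContinuousLinearEquiv : EuclideanSpace ℝ (Fin 3) →L[ℝ] EuclideanSpace ℝ (Fin 3))‖ ≤ 1 / 40; ∀ ρ ε : ℝ, 0 < ρ → 0 < ε → ∃ N₀ : ℕ, ∀ N : ℕ, N₀ ≤ N → ∀ x : Fin N → EuclideanSpace ℝ (Fin 3), Literature.MathematicalPhysics.StatisticalMechanics.IsGroundState Literature.MathematicalPhysics.StatisticalMechanics.lennardJones x → ∃ (c : EuclideanSpace ℝ (Fin 3)) (t : Fin 2 → EuclideanSpace ℝ (Fin 3)) (A : EuclideanSpace ℝ (Fin 3) →L[ℝ] EuclideanSpace ℝ (Fin 3)), Adm A ∧ Near (Set.range x) c ρ t A ε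

/-- item stmt-AtomisticToContinuum-4176 · crux · rank 2 · closed · moot by None · by planner
why it might fail: Crystallization-strength LJ input: fails if large ground states are fcc/polytype-grained (hcp beats fcc by only 7e-5/particle: hcp need not dominate before N~1e12, yet must eventually), polytetrahedral/amorphous (IcosahedralClusters, TetrahedralFrustration), foamy, or strained beyond the window.
sources: BlancLewin2015, Stillinger2001, KiharaKoba1952, PartayOrtnerCsanyi2017, Literature.Barriers.AtomisticToContinuum.IcosahedralClusters, Literature.Barriers.AtomisticToContinuum.TetrahedralFrustration
[crux] COARSE GRAINS AT ONE TOLERANCE (card (CG)/C4; the LJ physics of the line): for every R > 0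
there is N₀ such that every Lennard-Jones ground state with N ≥ N₀ particles contains a ball B_R(c)
two-way (1/40)-matched with an admissible affine hcp two-lattice t_m + A(Λ) (‖A − 0.97R‖ ≤ 1/40)
whose inner displacement is hcp-like (‖t₁ − t₀ − A(w + √(2/3)e₃)‖ ≤ 1/40, w = barlowOffset 1). ONE
window shape, ONE tolerance, no rate, no 'for every ε' — logically the weakest positional input
proposed on this summit (compare BulkDefectVanish stmt-0751: all but o(N) particles, every R AND
every ε; PeriodicWindows stmt-3240: every ε). Tolerance 1/40 is coarse enough for contact-graph
rigidity (bond lengths within a few % force it) yet below every known competing LJ equilibrium (bcc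
≈ 0.13 via the Burgers shuffle, stacking variants ≥ 0.28). Expected inputs when split later:
cohesion at scale R (cf. NoFoam stmt-2912), local hcp-likeness of low-energy neighbourhoods at
tolerance 1/40, O(N^{2/3}) defect counting, stacking selection by the r⁻⁶ tail (Hägg domination
items 0716/0737). [difficulty: open-problem] -/
@[route_item "route-AtomisticToContinuum-ExcessDecayRegularity"]
def CoarseGrains : Prop :=
  let Λ : Set (EuclideanSpace ℝ (Fin 3)) := {z | ∃ i j k : ℤ, z = (i : ℝ) • Literature.MathematicalPhysics.StatisticalMechanics.triangularVec₁ 1 + (j : ℝ) • Literature.MathematicalPhysics.StatisticalMechanics.triangularVec₂ 1 + (k : ℝ) • Literature.MathematicalPhysics.StatisticalMechanics.layerNormal (2 * Real.sqrt (2 / 3))}; let Near : Set (EuclideanSpace ℝ (Fin 3)) → EuclideanSpace ℝ (Fin 3) → ℝ → (Fin 2 → EuclideanSpace ℝ (Fin 3)) → (EuclideanSpace ℝ (Fin 3) →L[ℝ] EuclideanSpace ℝ (Fin 3)) → ℝ → Prop := fun X c r t A ε => (∀ p ∈ X, dist p c ≤ r → ∃ m : Fin 2, ∃ z ∈ Λ,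 dist p (t m + A z) ≤ ε) ∧ (∀ m : Fin 2, ∀ z ∈ Λ, dist (t m + A z) c ≤ r → ∃ p ∈ X, dist p (t m + A z) ≤ ε); let Adm : (EuclideanSpace ℝ (Fin 3) →L[ℝ] EuclideanSpace ℝ (Fin 3)) → Prop := fun A => ∃ R : EuclideanSpace ℝ (Fin 3) ≃ₗᵢ[ℝ] EuclideanSpace ℝ (Fin 3), ‖A - (97 / 100 : ℝ) • (R.toContinuousLinearEquiv : EuclideanSpace ℝ (Fin 3) →L[ℝ] EuclideanSpace ℝ (Fin 3))‖ ≤ 1 / 40; let Inner : (Fin 2 → EuclideanSpace ℝ (Fin 3)) → (EuclideanSpace ℝ (Fin 3) →L[ℝ] EuclideanSpace ℝ (Fin 3)) → Prop := fun t A => ‖t 1 - t 0 - A (Literature.MathematicalPhysics.StatisticalMechanics.barlowOffset 1 + Literature.MathematicalPhysics.StatisticalMechanics.layerNormal (Real.sqrt (2 / 3)))‖ ≤ 1 / 40; ∀ R : ℝ, 0 < R → ∃ N₀ : ℕ, ∀ N : ℕ, N₀ ≤ N → ∀ x : Fin N → EuclideanSpace ℝ (Fin 3), Literature.MathematicalPhysics.StatisticalMechanics.IsGroundState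 Literature.MathematicalPhysics.StatisticalMechanics.lennardJones x → ∃ (c : EuclideanSpace ℝ (Fin 3)) (t : Fin 2 → EuclideanSpace ℝ (Fin 3)) (A : EuclideanSpace ℝ (Fin 3) →L[ℝ] EuclideanSpace ℝ (Fin 3)), Adm A ∧ Inner t A ∧ Near (Set.range x) c R t A (1 / 40)

/-- item stmt-AtomisticToContinuum-4177 · crux · rank 3 · closed · moot by None · by planner
why it might fail: A competing LJ equilibrium within sup-distance 1/40 of affine hcp (modulated or inner-shifted two-lattice, static breather) refutes it; anharmonicity |V‴/V″|≈20 at the bond length puts the perturbative (IFT) radius near 1/400, so the coarse basin 1/40→ε₀ is the real bet; optical stability needed.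
sources: EhrlacherOrtnerShapeev2016, OlsonOrtner2017, EMing2006, ContiEtAl2006, Allard1972, HudsonOrtner2011
[crux] COARSE LIOUVILLE THEOREM FOR NEAR-HCP LJ EQUILIBRIA (the card's ε-regularity (ER) in
blow-down form; stated CONDITIONALLY on the harmonic-stability inequality of PhononStability, which
appears inline as the first hypothesis): for every δ > 0, every δ-separated set X ⊂ ℝ³ in
Lennard-Jones force balance (for each p ∈ X the force Σ_{q ∈ X, q ≠ p} V′(|p−q|)(p−q)/|p−q| has sum
0, HasSum form; absolutely convergent by the r⁻⁷ decay) that is GLOBALLY (every centre, every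
radius) two-way (1/40)-matched with an admissible affine hcp two-lattice datum (t, A) with hcp-like
inner displacement, IS exactly an admissible affine hcp two-lattice: X = {t′_m + A′z : m ∈ {0,1}, z
∈ Λ} with ‖A′ − 0.97R′‖ ≤ 1/40. (Uniformly strained two-lattices with relaxed inner shift are
equilibria and are allowed as conclusions; vacancies, interstitials, faults, dislocations,
half-crystals violate the two-way matching.) Regularity is a property of CRITICAL POINTS: no
minimality is assumed. Proof plan (layer 2): linear Liouville (bounded solutions of the hcp
force-constant system are translations — Fourier/Bloch + PhononStability incl. optical branches),
small-tolerance Liouville by iterating the excess-decay -/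
@[route_item "route-AtomisticToContinuum-ExcessDecayRegularity"]
def HcpLiouville : Prop :=
  let Λ : Set (EuclideanSpace ℝ (Fin 3)) := {z | ∃ i j k : ℤ, z = (i : ℝ) • Literature.MathematicalPhysics.StatisticalMechanics.triangularVec₁ 1 + (j : ℝ) • Literature.MathematicalPhysics.StatisticalMechanics.triangularVec₂ 1 + (k : ℝ) • Literature.MathematicalPhysics.StatisticalMechanics.layerNormal (2 * Real.sqrt (2 / 3))}; let Near : Set (EuclideanSpace ℝ (Fin 3)) → EuclideanSpace ℝ (Fin 3) → ℝ → (Fin 2 → EuclideanSpace ℝ (Fin 3)) → (EuclideanSpace ℝ (Fin 3) →L[ℝ] EuclideanSpace ℝ (Fin 3)) → ℝ → Prop := fun X c r t A ε => (∀ p ∈ X, dist p c ≤ r → ∃ m : Fin 2, ∃ z ∈ Λ, dist p (t m + A z) ≤ ε) ∧ (∀ m : Fin 2, ∀ z ∈ Λ, dist (t m + A z) c ≤ r → ∃ p ∈ X, dist p (t m + A z) ≤ ε); let Adm : (EuclideanSpace ℝ (Fin 3) →L[ℝ] EuclideanSpace ℝ (Fin 3)) → Prop := fun A => ∃ R : EuclideanSpace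 ℝ (Fin 3) ≃ₗᵢ[ℝ] EuclideanSpace ℝ (Fin 3), ‖A - (97 / 100 : ℝ) • (R.toContinuousLinearEquiv : EuclideanSpace ℝ (Fin 3) →L[ℝ] EuclideanSpace ℝ (Fin 3))‖ ≤ 1 / 40; let Inner : (Fin 2 → EuclideanSpace ℝ (Fin 3)) → (EuclideanSpace ℝ (Fin 3) →L[ℝ] EuclideanSpace ℝ (Fin 3)) → Prop := fun t A => ‖t 1 - t 0 - A (Literature.MathematicalPhysics.StatisticalMechanics.barlowOffset 1 + Literature.MathematicalPhysics.StatisticalMechanics.layerNormal (Real.sqrt (2 / 3)))‖ ≤ 1 / 40; let Sites : (Fin 2 → EuclideanSpace ℝ (Fin 3)) → (EuclideanSpace ℝ (Fin 3) →L[ℝ] EuclideanSpace ℝ (Fin 3)) → Set (EuclideanSpace ℝ (Fin 3)) := fun t A => {p | ∃ m : Fin 2, ∃ z ∈ Λ, p = t m + A z}; let Hess : EuclideanSpace ℝ (Fin 3) → EuclideanSpace ℝ (Fin 3) → ℝ := fun e w => deriv (deriv Literature.MathematicalPhysics.StatisticalMechanics.lennardJones) ‖e‖ * (inner ℝ e w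 / ‖e‖) ^ 2 + deriv Literature.MathematicalPhysics.StatisticalMechanics.lennardJones ‖e‖ / ‖e‖ * (‖w‖ ^ 2 - (inner ℝ e w / ‖e‖) ^ 2); let Sep : Set (EuclideanSpace ℝ (Fin 3)) → ℝ → Prop := fun X δ => ∀ p ∈ X, ∀ q ∈ X, p ≠ q → δ ≤ dist p q; let Equil : Set (EuclideanSpace ℝ (Fin 3)) → Prop := fun X => ∀ p ∈ X, HasSum (fun q : {q : EuclideanSpace ℝ (Fin 3) // q ∈ X ∧ q ≠ p} => (deriv Literature.MathematicalPhysics.StatisticalMechanics.lennardJones (dist p q.1) / dist p q.1) • (p - q.1)) 0; (∃ κ : ℝ, 0 < κ ∧ ∀ (t : Fin 2 → EuclideanSpace ℝ (Fin 3)) (A : EuclideanSpace ℝ (Fin 3) →L[ℝ] EuclideanSpace ℝ (Fin 3)), Adm A → Inner t A → ∀ u : EuclideanSpace ℝ (Fin 3) → EuclideanSpace ℝ (Fin 3), (Function.support u).Finite → Function.support u ⊆ Sites t A → κ * (∑' p : Sites t A, ∑' q : Sites t A, if dist (p : EuclideanSpace ℝ (Fin 3)) q ≤ 11 / 10 then ‖u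 p - u q‖ ^ 2 else 0) ≤ (∑' p : Sites t A, ∑' q : Sites t A, if (p : EuclideanSpace ℝ (Fin 3)) ≠ q then Hess ((p : EuclideanSpace ℝ (Fin 3)) - q) (u p - u q) else 0) / 2) → ∀ δ : ℝ, 0 < δ → ∀ X : Set (EuclideanSpace ℝ (Fin 3)), Sep X δ → Equil X → ∀ (t : Fin 2 → EuclideanSpace ℝ (Fin 3)) (A : EuclideanSpace ℝ (Fin 3) →L[ℝ] EuclideanSpace ℝ (Fin 3)), Adm A → Inner t A → (∀ (c : EuclideanSpace ℝ (Fin 3)) (r : ℝ), Near X c r t A (1 / 40)) → ∃ (t' : Fin 2 → EuclideanSpace ℝ (Fin 3)) (A' : EuclideanSpace ℝ (Fin 3) →L[ℝ] EuclideanSpace ℝ (Fin 3)), Adm A' ∧ X = Sites t' A'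

/-- item stmt-AtomisticToContinuum-4178 · crux · rank 4 · closed · moot by None · by planner
why it might fail: The window is a guess: the inequality must survive 2.6% triaxial strain and 1/40 inner shifts off equilibrium, where geometric-stress terms ΣV′/r of compressed bonds fight the moduli; LJ lattices can be harmonically unstable (bcc: BurrowsCooperSchwerdtfeger2021); repair = shrink window.
sources: HudsonOrtner2011, SchmidtSteinbach2022, AyalaChoksiWirth2025, EMing2006, BurrowsCooperSchwerdtfeger2021, book:dove1993-introduction-lattice-dynamics
[crux] HARMONIC (ACOUSTIC + OPTICAL / INNER-DISPLACEMENT) STABILITY OF LENNARD-JONES NEAR HCP,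
UNIFORM OVER THE ADMISSIBLE CELL WINDOW (card C1; a finite certified computation): there is κ > 0
such that for every admissible cell A (‖A − 0.97R‖ ≤ 1/40), all sublattice translations t with
hcp-like inner displacement (within 1/40), and every finitely supported displacement u of the site
set S = {t_m + Az}, the second variation of the LJ energy, ½ Σ_{p≠q ∈ S} (u_p−u_q)ᵀ K(p−q) (u_p−u_q)
with K(z) = V″(|z|) ẑ⊗ẑ + (V′(|z|)/|z|)(1 − ẑ⊗ẑ), V = r⁻¹²/12 − r⁻⁶/6, is ≥ κ · Σ_{p,q ∈ S, |p−q| ≤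
11/10} |u_p − u_q|² (nearest-neighbour strain norm; inter-sublattice bonds included, so optical
modes are controlled). Bloch reduction: a 6×6 Hermitian family over (Brillouin zone) × (compact
cell/shift window); interval arithmetic + explicit r⁻⁶/r⁻⁸ tail bounds + acoustic asymptotics D(q) ≥
c|q|² near q = 0 (Hudson–Ortner / Schmidt–Steinbach stability constants); AyalaChoksiWirth2025 Thm
4.1/4.4 already certify the Γ-sector for an 864-atom LJ fcc block. Also serves card
energy-derivative-positional-order (H4). [difficulty: L] -/
@[route_item "route-AtomisticToContinuum-ExcessDecayRegularity"]
def PhononStability : Prop :=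
  let Λ : Set (EuclideanSpace ℝ (Fin 3)) := {z | ∃ i j k : ℤ, z = (i : ℝ) • Literature.MathematicalPhysics.StatisticalMechanics.triangularVec₁ 1 + (j : ℝ) • Literature.MathematicalPhysics.StatisticalMechanics.triangularVec₂ 1 + (k : ℝ) • Literature.MathematicalPhysics.StatisticalMechanics.layerNormal (2 * Real.sqrt (2 / 3))}; let Adm : (EuclideanSpace ℝ (Fin 3) →L[ℝ] EuclideanSpace ℝ (Fin 3)) → Prop := fun A => ∃ R : EuclideanSpace ℝ (Fin 3) ≃ₗᵢ[ℝ] EuclideanSpace ℝ (Fin 3), ‖A - (97 / 100 : ℝ) • (R.toContinuousLinearEquiv : EuclideanSpace ℝ (Fin 3) →L[ℝ] EuclideanSpace ℝ (Fin 3))‖ ≤ 1 / 40; let Inner : (Fin 2 → EuclideanSpace ℝ (Fin 3)) → (EuclideanSpace ℝ (Fin 3) →L[ℝ] EuclideanSpace ℝ (Fin 3)) → Prop := fun t A => ‖t 1 - t 0 - A (Literature.MathematicalPhysics.StatisticalMechanics.barlowOffset 1 + Literature.MathematicalPhysics.StatisticalMechanics.layerNormal (Real.sqrt (2 / 3)))‖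 ≤ 1 / 40; let Sites : (Fin 2 → EuclideanSpace ℝ (Fin 3)) → (EuclideanSpace ℝ (Fin 3) →L[ℝ] EuclideanSpace ℝ (Fin 3)) → Set (EuclideanSpace ℝ (Fin 3)) := fun t A => {p | ∃ m : Fin 2, ∃ z ∈ Λ, p = t m + A z}; let Hess : EuclideanSpace ℝ (Fin 3) → EuclideanSpace ℝ (Fin 3) → ℝ := fun e w => deriv (deriv Literature.MathematicalPhysics.StatisticalMechanics.lennardJones) ‖e‖ * (inner ℝ e w / ‖e‖) ^ 2 + deriv Literature.MathematicalPhysics.StatisticalMechanics.lennardJones ‖e‖ / ‖e‖ * (‖w‖ ^ 2 - (inner ℝ e w / ‖e‖) ^ 2); ∃ κ : ℝ, 0 < κ ∧ ∀ (t : Fin 2 → EuclideanSpace ℝ (Fin 3)) (A : EuclideanSpace ℝ (Fin 3) →L[ℝ] EuclideanSpace ℝ (Fin 3)), Adm A → Inner t A → ∀ u : EuclideanSpace ℝ (Fin 3) → EuclideanSpace ℝ (Fin 3), (Function.support u).Finite → Function.support u ⊆ Sites t A → κ * (∑' p : Sites t A, ∑' q : Sites t A, if dist (p : EuclideanSpace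 ℝ (Fin 3)) q ≤ 11 / 10 then ‖u p - u q‖ ^ 2 else 0) ≤ (∑' p : Sites t A, ∑' q : Sites t A, if (p : EuclideanSpace ℝ (Fin 3)) ≠ q then Hess ((p : EuclideanSpace ℝ (Fin 3)) - q) (u p - u q) else 0) / 2

/-- item stmt-AtomisticToContinuum-4179 · support · rank 9 · closed · moot by None · by planner
sources: EhrlacherOrtnerShapeev2016, OlsonOrtner2017, EMing2006, Allard1972
[support] EXCESS DECAY = ALLARD-TYPE ε-REGULARITY WITH RATE (card (ER) in the absorbed form asked
for by refuter R4; foreseen layer-2 child of HcpLiouville in the small-tolerance regime; conditional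
on the PhononStability inequality, inline): for every δ > 0 there are ε₀ > 0, θ ∈ (0,1), r₀ and C
such that for every FINITE δ-separated LJ equilibrium X (force balance at every particle), every
ball B_r(c) with r ≥ r₀, every admissible datum (t, A) with hcp-like inner displacement and every ε
≤ ε₀: if X is two-way ε-matched with the datum on B_r(c) then on B_{θr}(c) it is (ε/2 +
C/r²)-matched with a corrected datum (t′, A′), ‖A′ − A‖ ≤ Cε/r. Mechanism: harmonic approximation
against the force-constant system of the nearest relaxed two-lattice, interior (Campanato) estimates
via the lattice Green's function, nonlinear remainder O(ε²) absorbed for ε ≤ ε₀, exterior matter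
acting only through a force O(s⁻⁴) at depth s (r⁻⁶ tail + δ-separation) whence the C/r² floor;
iterate ~log(1/η) times to reach tolerance η. Sources: EhrlacherOrtnerShapeev2016 Thm 2 (decay at
infinity for energy-space critical points), OlsonOrtner2017, EMing2006, Allard1972 (the template).
[difficulty: L] -/
@[route_item "route-AtomisticToContinuum-ExcessDecayRegularity"]
def ExcessDecay : Prop :=
  let Λ : Set (EuclideanSpace ℝ (Fin 3)) := {z | ∃ i j k : ℤ, z = (i : ℝ) • Literature.MathematicalPhysics.StatisticalMechanics.triangularVec₁ 1 + (j : ℝ) • Literature.MathematicalPhysics.StatisticalMechanics.triangularVec₂ 1 + (k : ℝ) • Literature.MathematicalPhysics.StatisticalMechanics.layerNormal (2 * Real.sqrt (2 / 3))}; let Near : Set (EuclideanSpace ℝ (Fin 3)) → EuclideanSpace ℝ (Fin 3) → ℝ → (Fin 2 → EuclideanSpace ℝ (Fin 3)) → (EuclideanSpace ℝ (Fin 3) →L[ℝ] EuclideanSpace ℝ (Fin 3)) → ℝ → Prop := fun X c r t A ε => (∀ p ∈ X, dist p c ≤ r → ∃ m : Fin 2, ∃ z ∈ Λ, dist p (t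 m + A z) ≤ ε) ∧ (∀ m : Fin 2, ∀ z ∈ Λ, dist (t m + A z) c ≤ r → ∃ p ∈ X, dist p (t m + A z) ≤ ε); let Adm : (EuclideanSpace ℝ (Fin 3) →L[ℝ] EuclideanSpace ℝ (Fin 3)) → Prop := fun A => ∃ R : EuclideanSpace ℝ (Fin 3) ≃ₗᵢ[ℝ] EuclideanSpace ℝ (Fin 3), ‖A - (97 / 100 : ℝ) • (R.toContinuousLinearEquiv : EuclideanSpace ℝ (Fin 3) →L[ℝ] EuclideanSpace ℝ (Fin 3))‖ ≤ 1 / 40; let Inner : (Fin 2 → EuclideanSpace ℝ (Fin 3)) → (EuclideanSpace ℝ (Fin 3) →L[ℝ] EuclideanSpace ℝ (Fin 3)) → Prop := fun t A => ‖t 1 - t 0 - A (Literature.MathematicalPhysics.StatisticalMechanics.barlowOffset 1 + Literature.MathematicalPhysics.StatisticalMechanics.layerNormal (Real.sqrt (2 / 3)))‖ ≤ 1 / 40; let Sites : (Fin 2 → EuclideanSpace ℝ (Fin 3)) → (EuclideanSpace ℝ (Fin 3) →L[ℝ] EuclideanSpace ℝ (Fin 3)) → Set (EuclideanSpace ℝ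 (Fin 3)) := fun t A => {p | ∃ m : Fin 2, ∃ z ∈ Λ, p = t m + A z}; let Hess : EuclideanSpace ℝ (Fin 3) → EuclideanSpace ℝ (Fin 3) → ℝ := fun e w => deriv (deriv Literature.MathematicalPhysics.StatisticalMechanics.lennardJones) ‖e‖ * (inner ℝ e w / ‖e‖) ^ 2 + deriv Literature.MathematicalPhysics.StatisticalMechanics.lennardJones ‖e‖ / ‖e‖ * (‖w‖ ^ 2 - (inner ℝ e w / ‖e‖) ^ 2); let Sep : Set (EuclideanSpace ℝ (Fin 3)) → ℝ → Prop := fun X δ => ∀ p ∈ X, ∀ q ∈ X, p ≠ q → δ ≤ dist p q; let Equil : Set (EuclideanSpace ℝ (Fin 3)) → Prop := fun X => ∀ p ∈ X, HasSum (fun q : {q : EuclideanSpace ℝ (Fin 3) // q ∈ X ∧ q ≠ p} => (deriv Literature.MathematicalPhysics.StatisticalMechanics.lennardJones (dist p q.1) / dist p q.1) • (p - q.1)) 0; (∃ κ : ℝ, 0 < κ ∧ ∀ (t : Fin 2 → EuclideanSpace ℝ (Fin 3)) (A : EuclideanSpace ℝ (Fin 3) →L[ℝ] EuclideanSpace ℝ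 (Fin 3)), Adm A → Inner t A → ∀ u : EuclideanSpace ℝ (Fin 3) → EuclideanSpace ℝ (Fin 3), (Function.support u).Finite → Function.support u ⊆ Sites t A → κ * (∑' p : Sites t A, ∑' q : Sites t A, if dist (p : EuclideanSpace ℝ (Fin 3)) q ≤ 11 / 10 then ‖u p - u q‖ ^ 2 else 0) ≤ (∑' p : Sites t A, ∑' q : Sites t A, if (p : EuclideanSpace ℝ (Fin 3)) ≠ q then Hess ((p : EuclideanSpace ℝ (Fin 3)) - q) (u p - u q) else 0) / 2) → ∀ δ : ℝ, 0 < δ → ∃ ε₀ θ r₀ C : ℝ, 0 < ε₀ ∧ 0 < θ ∧ θ < 1 ∧ ∀ X : Set (EuclideanSpace ℝ (Fin 3)), X.Finite → Sep X δ → Equil X → ∀ (c : EuclideanSpace ℝ (Fin 3)) (t : Fin 2 → EuclideanSpace ℝ (Fin 3)) (A : EuclideanSpace ℝ (Fin 3) →L[ℝ] EuclideanSpace ℝ (Fin 3)) (r ε : ℝ), Adm A → Inner t A → r₀ ≤ r → 0 < ε → ε ≤ ε₀ → Near X c r t A ε → ∃ (t' : Fin 2 → EuclideanSpace ℝ (Fin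 3)) (A' : EuclideanSpace ℝ (Fin 3) →L[ℝ] EuclideanSpace ℝ (Fin 3)), ‖A' - A‖ ≤ C * ε / r ∧ Near X c (θ * r) t' A' (ε / 2 + C / r ^ 2)

/-- item stmt-AtomisticToContinuum-4180 · support · rank 9 · closed · moot by None · by planner
sources: BlancLewin2015
[support] GROUND STATES ARE FORCE-BALANCED POINT SETS: for every Lennard-Jones ground state x (any
N) and every particle p ∈ range x, Σ_{q ∈ range x, q ≠ p} V′(|p−q|)·(p−q)/|p−q| = 0 (HasSum over the
finite subtype). Fermat at a minimum over the OPEN set of injective configurations; V_LJ = r⁻¹²/12 −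
r⁻⁶/6 is smooth on (0, ∞), dist is smooth off the diagonal. Needed by GrainsGlue. Provable now
(Mathlib calculus: IsLocalMin.hasFDerivAt_eq_zero / HasDerivAt of r ↦ V(‖p + r e − q‖)).
[difficulty: provable-now] -/
@[route_item "route-AtomisticToContinuum-ExcessDecayRegularity"]
def ForceBalance : Prop :=
  ∀ (N : ℕ) (x : Fin N → EuclideanSpace ℝ (Fin 3)), Literature.MathematicalPhysics.StatisticalMechanics.IsGroundState Literature.MathematicalPhysics.StatisticalMechanics.lennardJones x → ∀ p ∈ Set.range x, HasSum (fun q : {q : EuclideanSpace ℝ (Fin 3) // q ∈ Set.range x ∧ q ≠ p} => (deriv Literature.MathematicalPhysics.StatisticalMechanics.lennardJones (dist p q.1) / dist p q.1) • (p - q.1)) 0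

/-- item stmt-AtomisticToContinuum-4181 · support · rank 9 · closed · moot by None · by planner
sources: BlancLewin2015
[support] LAYER GLUE (foreseen split of the target): PhononStability → HcpLiouville → CoarseGrains →
FineGrains. Proof by compactness and contradiction: if fine grains fail for some (ρ, ε) along N_k →
∞, centre the coarse R_k-grains (R_k → ∞, CoarseGrains) of those ground states at 0 (translates of
ground states are ground states, CrystallizationSymmetries), normalise the data (t_k modulo A_kΛ;
A_k in the compact admissible set), extract a locally convergent subsequence of the 1/3-separated
translated configurations (LennardJonesMinimalDistance_holds; at most C n³ points in B_n by
card_le_of_separated_of_dist_le); the limit X_∞ is 1/3-separated, in force balance (ForceBalance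
passes to the limit: near field by local convergence, far field Σ_{|q−p| ≥ L} |V′| ≤ C L⁻⁴ uniformly
by separation) and globally two-way 1/40-matched with the limit datum (closed conditions; Λ
discrete); HcpLiouville (its stability hypothesis discharged by PhononStability) makes X_∞ an exact
admissible two-lattice; local convergence then gives two-way ε-matching of X_k with that two-lattice
on B_ρ(0) for large k — contradiction. [deps: PhononStability, HcpLiouville, CoarseGrains,
FineGrains, ForceBalance] [dif -/
@[route_item "route-AtomisticToContinuum-ExcessDecayRegularity"]
def GrainsGlue : Prop :=
  PhononStability → HcpLiouville → CoarseGrains → FineGrains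

/-- item stmt-AtomisticToContinuum-4182 · support · rank 9 · closed · moot by None · by planner
sources: BlancLewin2015
[support] FineGrains → IsCrystallizing lennardJones 3 (Blanc–Lewin (ii)): given ground states (x
N)_N take ρ_k = k, ε_k = 1/k and φ(k) ≥ N₀(k, 1/k) strictly increasing, with data (c_k, t_k, A_k)
from FineGrains; normalise t_k − c_k modulo A_kΛ (bounded), extract A_k → A, t_k → t (admissible
cells: a compact set of invertible maps, ‖A − 0.97R‖ ≤ 1/40 < 0.97); P := the periodic configuration
with lattice A(Λ) = Submodule.span ℤ {A u, A v, 2√(2/3)·A e₃} (IsZLattice/discrete since A is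
invertible) and motif {t₀, t₁} reduced modulo A(Λ) (a singleton if t₁ − t₀ ∈ A(Λ)); translations τ_j
:= −c_{φ j}; on a fixed ball B_R the matching error is ≤ 1/k + |t_k − t| + ‖A_k − A‖·O(R) → 0, so
PeriodicConfiguration.tendsto_sum_of_eventually_near' (CrystallizationLocalLimit.lean) with δ = 1/3
from LennardJonesMinimalDistance_holds yields local convergence with m ≡ 1 (an affinely strained hcp
is still a PeriodicConfiguration, so no zero-strain/Laplace lemma is needed). [deps: FineGrains]
[difficulty: M] -/
@[route_item "route-AtomisticToContinuum-ExcessDecayRegularity"]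
def LimitGlue : Prop :=
  FineGrains → Literature.MathematicalPhysics.StatisticalMechanics.IsCrystallizing Literature.MathematicalPhysics.StatisticalMechanics.lennardJones 3

-- TODO item stmt-AtomisticToContinuum-4183 · assembly · rank 1 · closed · moot by None · by planner — BLOCKED: missing decl(s) CrysEnergyLimit, CrysPeriodicMinAttained; restate via `ledger route edit` once they land:
--   def Assembly : Prop := GrainsGlue → LimitGlue → PhononStability → HcpLiouville → CoarseGrains → CrysPeriodicMinAttained → CrysEnergyLimit → Literature.MathematicalPhysics.StatisticalMechanics.Crystallization

end Summit.AtomisticToContinuum.Crystallization.Theses.ExcessDecayRegularity
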